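import Summits.HubbardSuperconductivity.HubbardSuperconductivity.Theorems.SoloBlindWeightedCondensate
import Summits.HubbardSuperconductivity.HubbardSuperconductivity.Theorems.SoloBlindCanonicalOccupation
import HarnessLib

/-!
# Energy balance of the weighted condensate in occupation form (solo-blind programme, Theorem 28)

For the weighted pair condensate `Ψ = Ψ^φ_{A, M+2}` (`SoloBlindWeightedCondensate`), weights
`x = φ²`, symmetric sums `C_j = e_j(x; A)`, `E_j(k) = e_j(x; A ∖ k)`, a Fermi set `F ⊆ A` with
`#F = M + 2` and a separating level `μ` (`ε ≤ μ` on `F`, `μ ≤ ε` on `A ∖ F`):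

* `kinetic_identity`: `re⟨Ψ, H₀Ψ⟩ - 2(Σ_F ε) C_{M+2}
    = 2 Σ_{A∖F} (ε_k - μ) x_k E_{M+1}(k) + 2 Σ_F (μ - ε_k) E_{M+2}(k)` (Euler's identity
  `Σ_k x_k E_{M+1}(k) = (M+2) C_{M+2}` kills the `μ`-term: the particle number is exact);
* in the FUGACITY WINDOW `C_{M+2} < 2C_{M+1}`, `C_{M+2} < 2C_{M+3}`, `C_{M+1} ≤ C_{M+2}`
  (supplied by `fugacity_window` and `esy_symmetric_point`): the occupation sandwich of
  `SoloBlindCanonicalOccupation` gives `x_k E_{M+1}(k) ≤ [2x_k/(1+2x_k)] C_{M+2}` (particles),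
  `E_{M+2}(k) ≤ [2/(2+x_k)] C_{M+2}` (holes) and `C_{M+1} C_{M+2} ≤ (1+x_k)(2+x_k) E_{M+1}(k)²`
  (coherence), hence the KINETIC BOUND `kinetic_le` and the quadratic GAIN BOUND `gain_ge`:
  `(Σ_{k∈A} |w_k| g_k)² C_{M+2} ≤ re⟨Ψ, ΔᴴΔ Ψ⟩` whenever `g_k²(1+x_k)(2+x_k) ≤ x_k` and the signs
  of `φ_k` follow those of `w_k`.

Dividing by `‖Ψ‖² = C_{M+2}` this is the bracket of report §5.20 (6) (item E6a; claim C53):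
`⟨H₀ - (g/L²)ΔᴴΔ⟩_Ψ - E^{free}_{sector}
  ≤ 2Σ_{A∖F}(ε-μ)·2x/(1+2x) + 2Σ_F(μ-ε)·2/(2+x) - (g/L²)(Σ_A |w| g)²`. [this work]
-/

noncomputable section

namespace Summit.HubbardSuperconductivity.HubbardSuperconductivity.Theorems.EnergyBalance

open Matrix Finset Literature.Probability.LatticeModels
  Literature.MathematicalPhysics.QuantumLattice
  Summit.HubbardSuperconductivity.HubbardSuperconductivity.Theorems.PairCondensate
  Summit.HubbardSuperconductivity.HubbardSuperconductivity.Theorems.WeightedCondensate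
  Summit.HubbardSuperconductivity.HubbardSuperconductivity.Theorems.CanonicalOccupation
open scoped ComplexOrder ComplexConjugate

/-- `esy[x, s, j]` = the `j`-th elementary symmetric sum of the weights `x` over `s`. -/
local notation "esy[" x ", " s ", " j "]" =>
  (∑ t ∈ Finset.powersetCard j s, ∏ k ∈ t, x k)

/-! ### The three window inequalities (elementary symmetric sums) -/

section Window

variable {α : Type*} [DecidableEq α]

/-- PARTICLES: `C_{M+2} < 2C_{M+3}` gives `x_a E_{M+1}(s)(1 + 2x_a) ≤ 2x_a C_{M+2}`. [this work] -/
theorem particle_bound {x : α → ℝ} {s : Finset α} (hx : ∀ k ∈ s, 0 ≤ x k) {a : α} (ha : a ∉ s)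
    (hxa : 0 ≤ x a) (M : ℕ) (hC : 0 < esy[x, insert a s, M + 2])
    (hW : esy[x, insert a s, M + 2] < 2 * esy[x, insert a s, M + 3]) :
    x a * esy[x, s, M + 1] * (1 + 2 * x a) ≤ 2 * x a * esy[x, insert a s, M + 2] := by
  have h := occupation_upper_prodForm hx ha (M + 1)
  have e1 : M + 1 + 2 = M + 3 := by ring
  have e2 : M + 1 + 1 = M + 2 := by ring
  rw [e1, e2] at h
  have hE : 0 ≤ esy[x, s, M + 1] := esy_nonneg hx _
  have h2 : esy[x, s, M + 1] * (1 + 2 * x a) ≤ 2 * esy[x, insert a s, M + 2] := by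
    by_contra h3
    rw [not_le] at h3
    have h4 : esy[x, insert a s, M + 2] * (2 * esy[x, insert a s, M + 2]) <
        esy[x, insert a s, M + 2] * (esy[x, s, M + 1] * (1 + 2 * x a)) :=
      mul_lt_mul_of_pos_left h3 hC
    nlinarith [mul_le_mul_of_nonneg_left hW.le hE]
  nlinarith [mul_le_mul_of_nonneg_left h2 hxa]

/-- HOLES (first form): `C_{M+2} < 2C_{M+1}` gives `C_{M+2} ≤ (2 + x_a) E_{M+1}(s)`. [this work] -/
theorem level_le_hole {x : α → ℝ} {s : Finset α} (hx : ∀ k ∈ s, 0 ≤ x k) {a : α} (ha : a ∉ s)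
    (hxa : 0 ≤ x a) (M : ℕ) (hC : 0 < esy[x, insert a s, M + 1])
    (hW : esy[x, insert a s, M + 2] < 2 * esy[x, insert a s, M + 1]) :
    esy[x, insert a s, M + 2] ≤ (2 + x a) * esy[x, s, M + 1] := by
  have h := occupation_lower_prodForm hx ha hxa (M + 1)
  have e2 : M + 1 + 1 = M + 2 := by ring
  rw [e2] at h
  have hE : 0 ≤ esy[x, s, M + 1] := esy_nonneg hx _
  by_contra h3
  rw [not_le] at h3
  have h4 : esy[x, insert a s, M + 1] * ((2 + x a) * esy[x, s, M + 1]) <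
      esy[x, insert a s, M + 1] * esy[x, insert a s, M + 2] := mul_lt_mul_of_pos_left h3 hC
  nlinarith [mul_le_mul_of_nonneg_left hW.le hE, mul_nonneg hxa hE]

/-- HOLES: `C_{M+2} < 2C_{M+1}` gives `(2 + x_a) E_{M+2}(s) ≤ 2 C_{M+2}`. [this work] -/
theorem hole_bound {x : α → ℝ} {s : Finset α} (hx : ∀ k ∈ s, 0 ≤ x k) {a : α} (ha : a ∉ s)
    (hxa : 0 ≤ x a) (M : ℕ) (hC : 0 < esy[x, insert a s, M + 1])
    (hW : esy[x, insert a s, M + 2] < 2 * esy[x, insert a s, M + 1]) :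
    (2 + x a) * esy[x, s, M + 2] ≤ 2 * esy[x, insert a s, M + 2] := by
  have h := level_le_hole hx ha hxa M hC hW
  have hins := esy_insert_succ x ha (M + 1)
  have e2 : M + 1 + 1 = M + 2 := by ring
  rw [e2] at hins
  rw [hins] at h ⊢
  nlinarith [mul_le_mul_of_nonneg_left h hxa]

/-- COHERENCE: `C_{M+2} < 2C_{M+1}` and `C_{M+1} ≤ C_{M+2}` give
`C_{M+1} C_{M+2} ≤ (1 + x_a)(2 + x_a) E_{M+1}(s)²`. [this work] -/
theorem coherence_bound {x : α → ℝ} {s : Finset α} (hx : ∀ k ∈ s, 0 ≤ x k) {a : α} (ha : a ∉ s)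
    (hxa : 0 ≤ x a) (M : ℕ) (hC : 0 < esy[x, insert a s, M + 1])
    (hW : esy[x, insert a s, M + 2] < 2 * esy[x, insert a s, M + 1])
    (hmono : esy[x, insert a s, M + 1] ≤ esy[x, insert a s, M + 2]) :
    esy[x, insert a s, M + 1] * esy[x, insert a s, M + 2] ≤
      (1 + x a) * (2 + x a) * esy[x, s, M + 1] ^ 2 := by
  have h1 := level_le_hole hx ha hxa M hC hW
  -- `E_M ≤ E_{M+1}` from the upper product form and `C_{M+1} ≤ C_{M+2}`
  have h := occupation_upper_prodForm hx ha M
  have hins := esy_insert_succ x ha M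
  have hEM : 0 ≤ esy[x, s, M] := esy_nonneg hx _
  have hE : 0 ≤ esy[x, s, M + 1] := esy_nonneg hx _
  have h2 : esy[x, insert a s, M + 1] ≤ (1 + x a) * esy[x, s, M + 1] := by
    have h3 : esy[x, s, M] * ((1 + x a) * esy[x, insert a s, M + 1]) ≤
        esy[x, insert a s, M + 1] ^ 2 := by
      nlinarith [mul_le_mul_of_nonneg_left hmono (mul_nonneg hxa hEM)]
    have h4 : esy[x, s, M] * (1 + x a) ≤ esy[x, insert a s, M + 1] := by
      by_contra h5
      rw [not_le] at h5
      nlinarith [mul_lt_mul_of_pos_left h5 hC]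
    rw [hins] at h4 ⊢
    nlinarith
  have hC2 : 0 ≤ esy[x, insert a s, M + 2] := le_of_lt (lt_of_lt_of_le hC hmono)
  calc esy[x, insert a s, M + 1] * esy[x, insert a s, M + 2]
      ≤ ((1 + x a) * esy[x, s, M + 1]) * ((2 + x a) * esy[x, s, M + 1]) :=
        mul_le_mul h2 h1 hC2 (by positivity)
    _ = (1 + x a) * (2 + x a) * esy[x, s, M + 1] ^ 2 := by ring

end Window

/-! ### The condensate: kinetic identity, kinetic bound, gain bound -/

variable {L : ℕ} [NeZero L]

local notation "Φ[" S "]" =>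
  (List.prod (List.map (fun k : TorusSite 2 _ => (pairMode k)ᴴ) (Finset.toList S)) *ᵥ
    (vacuum : Fock (Orb (FermionTorus 2 _))))

/-- The `d`-wave profile `w_k = pairFieldMode dWaveFormFactor L k`. -/
local notation "W[" k "]" => (pairFieldMode dWaveFormFactor _ k)

/-- The weighted number-projected condensate `Ψ^φ_{A,i} = Σ_{S ⊆ A, |S| = i} (Π_{k∈S} φ_k) Φ_S`. -/
local notation "Ψ[" φ ", " A " ; " i "]" =>
  (∑ S ∈ Finset.powersetCard i A, ((((∏ k ∈ S, φ k : ℝ))) : ℂ) • Φ[S])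

omit [NeZero L] in
/-- EULER'S IDENTITY for the canonical ensemble: `Σ_{k∈A} x_k E_{M+1}(k) = (M+2) C_{M+2}`
(the particle number of `Ψ_{M+2}` is exactly `M + 2`). [folklore] -/
theorem sum_mul_esy_erase (x : TorusSite 2 L → ℝ) (A : Finset (TorusSite 2 L)) (M : ℕ) :
    ∑ k ∈ A, x k * esy[x, A.erase k, M + 1] = (M + 2) * esy[x, A, M + 2] := by
  have h := sum_prod_mul_sum_mem_eq x (fun _ => (1 : ℝ)) A (M + 1)
  simp only [sum_const, nsmul_eq_mul, mul_one, one_mul] at h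
  rw [← h, mul_sum]
  refine sum_congr rfl fun S hS => ?_
  rw [(mem_powersetCard.1 hS).2]
  push_cast
  ring

/-- **Theorem 28a (kinetic identity).** For `F ⊆ A` with `#F = M + 2` and any `μ`:
`re⟨Ψ, H₀Ψ⟩ - 2(Σ_F ε)C_{M+2} = 2Σ_{A∖F}(ε-μ) x E_{M+1}(k) + 2Σ_F (μ-ε) E_{M+2}(k)`. [this work] -/
theorem kinetic_identity (hL : 3 ≤ L) (φ : TorusSite 2 L → ℝ) (A F : Finset (TorusSite 2 L))
    (hFA : F ⊆ A) (M : ℕ) (hF : #F = M + 2) (μ : ℝ) :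
    (star Ψ[φ, A ; M + 2] ⬝ᵥ (hubbardTorus 2 L 1 0 *ᵥ Ψ[φ, A ; M + 2])).re -
        2 * (∑ k ∈ F, torusBand L k) * esy[fun k => φ k ^ 2, A, M + 2] =
      2 * ∑ k ∈ A \ F, (torusBand L k - μ) *
          (φ k ^ 2 * esy[fun k => φ k ^ 2, A.erase k, M + 1]) +
        2 * ∑ k ∈ F, (μ - torusBand L k) * esy[fun k => φ k ^ 2, A.erase k, M + 2] := by
  rw [re_expect_hubbardTorus_zero_wcond hL, sum_prod_mul_sum_mem_eq]
  have heu := sum_mul_esy_erase (fun k => φ k ^ 2) A M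
  have h4a := sum_sdiff hFA
    (f := fun k => torusBand L k * (φ k ^ 2 * esy[fun k => φ k ^ 2, A.erase k, M + 1]))
  have h4b := sum_sdiff hFA (f := fun k => φ k ^ 2 * esy[fun k => φ k ^ 2, A.erase k, M + 1])
  have hX : ∑ k ∈ A \ F, (torusBand L k - μ) *
        (φ k ^ 2 * esy[fun k => φ k ^ 2, A.erase k, M + 1]) =
      ∑ k ∈ A \ F, torusBand L k * (φ k ^ 2 * esy[fun k => φ k ^ 2, A.erase k, M + 1]) -
        μ * ∑ k ∈ A \ F, φ k ^ 2 * esy[fun k => φ k ^ 2, A.erase k, M + 1] := by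
    rw [mul_sum, ← sum_sub_distrib]
    exact sum_congr rfl fun k _ => by ring
  have hb : ∀ k ∈ F, esy[fun k => φ k ^ 2, A.erase k, M + 2] =
      esy[fun k => φ k ^ 2, A, M + 2] - φ k ^ 2 * esy[fun k => φ k ^ 2, A.erase k, M + 1] := by
    intro k hk
    have h := esy_insert_succ (fun k => φ k ^ 2) (Finset.notMem_erase k A) (M + 1)
    rw [Finset.insert_erase (hFA hk)] at h
    rw [h]
    ring
  have hY : ∑ k ∈ F, (μ - torusBand L k) * esy[fun k => φ k ^ 2, A.erase k, M + 2] =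
      (M + 2) * (μ * esy[fun k => φ k ^ 2, A, M + 2]) -
        μ * ∑ k ∈ F, φ k ^ 2 * esy[fun k => φ k ^ 2, A.erase k, M + 1] -
        esy[fun k => φ k ^ 2, A, M + 2] * ∑ k ∈ F, torusBand L k +
        ∑ k ∈ F, torusBand L k * (φ k ^ 2 * esy[fun k => φ k ^ 2, A.erase k, M + 1]) := by
    have h1 : ∀ k ∈ F, (μ - torusBand L k) * esy[fun k => φ k ^ 2, A.erase k, M + 2] =
        (μ * esy[fun k => φ k ^ 2, A, M + 2] - esy[fun k => φ k ^ 2, A, M + 2] * torusBand L k)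
          + (torusBand L k * (φ k ^ 2 * esy[fun k => φ k ^ 2, A.erase k, M + 1]) -
            μ * (φ k ^ 2 * esy[fun k => φ k ^ 2, A.erase k, M + 1])) := by
      intro k hk
      rw [hb k hk]
      ring
    rw [sum_congr rfl h1, sum_add_distrib, sum_sub_distrib, sum_sub_distrib, sum_const, hF,
      ← mul_sum, ← mul_sum, nsmul_eq_mul]
    push_cast
    ring
  linear_combination (-2 : ℝ) * h4a + 2 * μ * h4b + 2 * μ * heu - 2 * hX - 2 * hY

/-- **Theorem 28b (kinetic bound in the fugacity window).** With `x = φ²`, `C_j = e_j(x;A)`,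
`0 < C_{M+1}`, `0 < C_{M+2}`, `C_{M+2} < 2C_{M+1}`, `C_{M+2} < 2C_{M+3}` and a separating level
`μ` (`ε ≤ μ` on `F`, `μ ≤ ε` on `A ∖ F`, `F ⊆ A`, `#F = M+2`):
`re⟨Ψ,H₀Ψ⟩ - 2(Σ_F ε)C_{M+2} ≤ 2Σ_{A∖F}(ε-μ)·[2x/(1+2x)]C_{M+2} + 2Σ_F(μ-ε)·[2/(2+x)]C_{M+2}`.
[this work] -/
theorem kinetic_le (hL : 3 ≤ L) (φ : TorusSite 2 L → ℝ) (A F : Finset (TorusSite 2 L))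
    (hFA : F ⊆ A) (M : ℕ) (hF : #F = M + 2) (μ : ℝ)
    (hsep : ∀ k ∈ F, torusBand L k ≤ μ) (hsep' : ∀ k ∈ A \ F, μ ≤ torusBand L k)
    (hC1 : 0 < esy[fun k => φ k ^ 2, A, M + 1]) (hC2 : 0 < esy[fun k => φ k ^ 2, A, M + 2])
    (hW1 : esy[fun k => φ k ^ 2, A, M + 2] < 2 * esy[fun k => φ k ^ 2, A, M + 1])
    (hW2 : esy[fun k => φ k ^ 2, A, M + 2] < 2 * esy[fun k => φ k ^ 2, A, M + 3]) :
    (star Ψ[φ, A ; M + 2] ⬝ᵥ (hubbardTorus 2 L 1 0 *ᵥ Ψ[φ, A ; M + 2])).re -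
        2 * (∑ k ∈ F, torusBand L k) * esy[fun k => φ k ^ 2, A, M + 2] ≤
      2 * ∑ k ∈ A \ F, (torusBand L k - μ) *
          (2 * φ k ^ 2 / (1 + 2 * φ k ^ 2) * esy[fun k => φ k ^ 2, A, M + 2]) +
        2 * ∑ k ∈ F, (μ - torusBand L k) *
          (2 / (2 + φ k ^ 2) * esy[fun k => φ k ^ 2, A, M + 2]) := by
  rw [kinetic_identity hL φ A F hFA M hF μ]
  have hx : ∀ k, ∀ j ∈ A.erase k, 0 ≤ (fun k => φ k ^ 2) j := fun k j _ => sq_nonneg (φ j)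
  have hP : ∀ k ∈ A \ F, φ k ^ 2 * esy[fun k => φ k ^ 2, A.erase k, M + 1] ≤
      2 * φ k ^ 2 / (1 + 2 * φ k ^ 2) * esy[fun k => φ k ^ 2, A, M + 2] := by
    intro k hk
    have hkA : k ∈ A := (mem_sdiff.1 hk).1
    have h := particle_bound (hx k) (Finset.notMem_erase k A) (sq_nonneg (φ k)) M
    rw [Finset.insert_erase hkA] at h
    have h' := h hC2 hW2
    rw [div_mul_eq_mul_div, le_div_iff₀ (by positivity)]
    linarith
  have hH : ∀ k ∈ F, esy[fun k => φ k ^ 2, A.erase k, M + 2] ≤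
      2 / (2 + φ k ^ 2) * esy[fun k => φ k ^ 2, A, M + 2] := by
    intro k hk
    have h := hole_bound (hx k) (Finset.notMem_erase k A) (sq_nonneg (φ k)) M
    rw [Finset.insert_erase (hFA hk)] at h
    have h' := h hC1 hW1
    rw [div_mul_eq_mul_div, le_div_iff₀ (by positivity)]
    linarith
  have h1 : ∑ k ∈ A \ F, (torusBand L k - μ) *
        (φ k ^ 2 * esy[fun k => φ k ^ 2, A.erase k, M + 1]) ≤
      ∑ k ∈ A \ F, (torusBand L k - μ) *
        (2 * φ k ^ 2 / (1 + 2 * φ k ^ 2) * esy[fun k => φ k ^ 2, A, M + 2]) :=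
    sum_le_sum fun k hk => mul_le_mul_of_nonneg_left (hP k hk) (by linarith [hsep' k hk])
  have h2 : ∑ k ∈ F, (μ - torusBand L k) * esy[fun k => φ k ^ 2, A.erase k, M + 2] ≤
      ∑ k ∈ F, (μ - torusBand L k) * (2 / (2 + φ k ^ 2) * esy[fun k => φ k ^ 2, A, M + 2]) :=
    sum_le_sum fun k hk => mul_le_mul_of_nonneg_left (hH k hk) (by linarith [hsep k hk])
  linarith

/-- **Theorem 28c (quadratic gain bound in the fugacity window).** With `x = φ²`,
`0 < C_{M+1}`, `C_{M+2} < 2C_{M+1}`, `C_{M+1} ≤ C_{M+2}`, signs `w_k φ_k ≥ 0` and any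
`g_k ≥ 0` with `g_k²(1+x_k)(2+x_k) ≤ x_k` on `A`:
`(Σ_{k∈A} |w_k| g_k)² · C_{M+2} ≤ re⟨Ψ_{M+2}, ΔᴴΔ Ψ_{M+2}⟩`. [this work] -/
theorem gain_ge (φ g : TorusSite 2 L → ℝ) (A : Finset (TorusSite 2 L)) (M : ℕ)
    (hC1 : 0 < esy[fun k => φ k ^ 2, A, M + 1])
    (hW1 : esy[fun k => φ k ^ 2, A, M + 2] < 2 * esy[fun k => φ k ^ 2, A, M + 1])
    (hmono : esy[fun k => φ k ^ 2, A, M + 1] ≤ esy[fun k => φ k ^ 2, A, M + 2])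
    (hφW : ∀ k ∈ A, 0 ≤ W[k] * φ k) (hg0 : ∀ k ∈ A, 0 ≤ g k)
    (hg : ∀ k ∈ A, g k ^ 2 * ((1 + φ k ^ 2) * (2 + φ k ^ 2)) ≤ φ k ^ 2) :
    (∑ k ∈ A, |W[k]| * g k) ^ 2 * esy[fun k => φ k ^ 2, A, M + 2] ≤
      (star Ψ[φ, A ; M + 2] ⬝ᵥ
        ((pairField dWaveFormFactor L)ᴴ * pairField dWaveFormFactor L) *ᵥ Ψ[φ, A ; M + 2]).re := by
  have h := wcond_order_ge φ A (M + 1)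
  rw [sum_prod_mul_sum_sdiff_eq] at h
  set C1 := esy[fun k => φ k ^ 2, A, M + 1] with hC1def
  set C2 := esy[fun k => φ k ^ 2, A, M + 2] with hC2def
  have hC2 : 0 ≤ C2 := hC1.le.trans hmono
  have hx : ∀ k, ∀ j ∈ A.erase k, 0 ≤ (fun k => φ k ^ 2) j := fun k j _ => sq_nonneg (φ j)
  -- termwise: `|w_k| g_k √(C₁C₂) ≤ w_k φ_k E_{M+1}(k)`
  have hterm : ∀ k ∈ A, |W[k]| * g k * Real.sqrt (C1 * C2) ≤
      W[k] * φ k * esy[fun k => φ k ^ 2, A.erase k, M + 1] := by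
    intro k hk
    have hE : 0 ≤ esy[fun k => φ k ^ 2, A.erase k, M + 1] := esy_nonneg (hx k) _
    have hcoh := coherence_bound (hx k) (Finset.notMem_erase k A) (sq_nonneg (φ k)) M
    rw [Finset.insert_erase hk] at hcoh
    have hcoh' := hcoh hC1 hW1 hmono
    have hu : 0 ≤ |W[k]| * g k * Real.sqrt (C1 * C2) :=
      mul_nonneg (mul_nonneg (abs_nonneg _) (hg0 k hk)) (Real.sqrt_nonneg _)
    have hv : 0 ≤ W[k] * φ k * esy[fun k => φ k ^ 2, A.erase k, M + 1] :=
      mul_nonneg (hφW k hk) hE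
    have hsq : (|W[k]| * g k * Real.sqrt (C1 * C2)) ^ 2 ≤
        (W[k] * φ k * esy[fun k => φ k ^ 2, A.erase k, M + 1]) ^ 2 := by
      rw [mul_pow, mul_pow, Real.sq_sqrt (mul_nonneg hC1.le hC2), sq_abs, mul_pow, mul_pow]
      have h1 : g k ^ 2 * (C1 * C2) ≤ φ k ^ 2 * esy[fun k => φ k ^ 2, A.erase k, M + 1] ^ 2 := by
        calc g k ^ 2 * (C1 * C2)
            ≤ g k ^ 2 * ((1 + φ k ^ 2) * (2 + φ k ^ 2) *
                esy[fun k => φ k ^ 2, A.erase k, M + 1] ^ 2) :=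
              mul_le_mul_of_nonneg_left hcoh' (sq_nonneg _)
          _ = g k ^ 2 * ((1 + φ k ^ 2) * (2 + φ k ^ 2)) *
                esy[fun k => φ k ^ 2, A.erase k, M + 1] ^ 2 := by ring
          _ ≤ φ k ^ 2 * esy[fun k => φ k ^ 2, A.erase k, M + 1] ^ 2 :=
              mul_le_mul_of_nonneg_right (hg k hk) (sq_nonneg _)
      nlinarith [sq_nonneg (W[k]), h1]
    have := Real.sqrt_le_sqrt hsq
    rwa [Real.sqrt_sq hu, Real.sqrt_sq hv] at this
  have hS0 : (∑ k ∈ A, |W[k]| * g k) * Real.sqrt (C1 * C2) ≤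
      ∑ k ∈ A, W[k] * φ k * esy[fun k => φ k ^ 2, A.erase k, M + 1] := by
    rw [sum_mul]
    exact sum_le_sum hterm
  have hS0nn : 0 ≤ (∑ k ∈ A, |W[k]| * g k) * Real.sqrt (C1 * C2) :=
    mul_nonneg (sum_nonneg fun k hk => mul_nonneg (abs_nonneg _) (hg0 k hk)) (Real.sqrt_nonneg _)
  have hsq := pow_le_pow_left₀ hS0nn hS0 2
  rw [mul_pow, Real.sq_sqrt (mul_nonneg hC1.le hC2)] at hsq
  have e2 : M + 1 + 1 = M + 2 := rfl
  rw [e2] at h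
  -- `(Σ|w|g)² C₁ C₂ ≤ S² ≤ C₁ · R`
  have h3 : (∑ k ∈ A, |W[k]| * g k) ^ 2 * (C1 * C2) ≤ C1 *
      (star Ψ[φ, A ; M + 2] ⬝ᵥ
        ((pairField dWaveFormFactor L)ᴴ * pairField dWaveFormFactor L) *ᵥ Ψ[φ, A ; M + 2]).re :=
    hsq.trans h
  have h4 : C1 * ((∑ k ∈ A, |W[k]| * g k) ^ 2 * C2) ≤ C1 *
      (star Ψ[φ, A ; M + 2] ⬝ᵥ
        ((pairField dWaveFormFactor L)ᴴ * pairField dWaveFormFactor L) *ᵥ Ψ[φ, A ; M + 2]).re := by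
    calc C1 * ((∑ k ∈ A, |W[k]| * g k) ^ 2 * C2)
        = (∑ k ∈ A, |W[k]| * g k) ^ 2 * (C1 * C2) := by ring
      _ ≤ _ := h3
  exact le_of_mul_le_mul_left h4 hC1

end Summit.HubbardSuperconductivity.HubbardSuperconductivity.Theorems.EnergyBalance
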